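import Mathlib
import Literature.MathematicalPhysics.QuantumFieldTheory.Balaban1983to89.B12
import Literature.MathematicalPhysics.QuantumFieldTheory.Balaban1983to89.B13FamilySum
import Literature.Probability.LatticeModels.PolymerGasGeometric

/-!
# Bałaban, *Renormalization group approach to lattice gauge field theories* I (CMP 109, 1987) and II (CMP 116,
# 1988) — the tree-decay summability `Σ_{X∈𝐃_j, X⊃□} exp(−κ d_j(X)) ≤ O(1)` ((1.26) of [II]; the SILENT input of
# the chains (0.26)/(0.30) of [I]), KERNEL-CHECKED from the lattice-animal count modulo ONE quoted geometric leaf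

Sources reproduced (statement level + kernel bookkeeping; nothing of the series is asserted):

* T. Bałaban, *Renormalization group approach to lattice gauge field theories. I. Generation of effective actions
  in a small field approximation and a coupling constant renormalization in four dimensions*, Commun. Math. Phys.
  **109** (1987) 249–301 [`Balaban1987RG1`] — p. 257 [PDF 9]: the cubes `π_j`, the localization domains `𝐃_j` =
  *"a union of a connected, finite family of cubes from π_j. A connected family means that for every pair □, □′ of
  cubes from the family there exists a sequence □, □₁, …, □_n, □′ of cubes belonging to the family and such that
  two consecutive cubes have a common wall, i.e. their intersection is a d−1-dimensional cube"*, the linear size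
  `d_j(X)`; pp. 257–258 [9–10]: the third members `≤ Σ_{□∈π_j} … O(1)` of the chains (0.26) and (0.30), which use
  the summability below WITHOUT reference or proof at that place (cell GAPS.md G-pv03-1; in the tree it is the
  explicit hypothesis `hTree` of `B12.chain026_holds`, `B12.chain030_holds`, `B12.uvStable030_of_repr`,
  `B12.uvStable030_of_thm1`, module `B12`, surge node T09.1).
* T. Bałaban, *Renormalization group approach to lattice gauge field theories. II. Cluster expansions*, Commun.
  Math. Phys. **116** (1988) 1–22 [`Balaban1988RG2Cluster`] — p. 8 [PDF 8] **(1.26)**, verbatim: *"For the second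
  sum we have  Σ_{X∈𝐃_j, X⊃□′} exp(−κd_j(X)) ≤ O(1),  (1.26)  for κ sufficiently large. The number O(1) is in fact
  small, because we sum over X with d_j(X) ≠ 0, as it follows from our inductive construction. This inequality was
  used many times in convergence proofs for cluster expansions, for example see [48, 50, 40, 26, 3]."* — the only
  place in the series where the summability is displayed; stated BY REFERENCE (cell GAPS.md G-B13-04).
* J. Dimock, *The renormalization group according to Balaban. I. Small fields*, Rev. Math. Phys. **25** (2013)
  1330010 [`Dimock2013`; arXiv:1108.1335v2, TeX source `inputs/files/dimock/src/1108.1335/1108.1335.tex`] —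
  App. A Lemma 25 (`\label{totalbasic}`, TeX L3080–3095), verbatim: *"1. There are constants a, b such that for
  any □  Σ_{X: X⊃□} exp(−a|X|_M) ≤ b  (basic1).  2. There are constants κ₀, K₀ such that for any □
  Σ_{X: X⊃□} exp(−κ₀ d_M(X)) ≤ K₀  (basic2)"*, *"The constants depend only on the dimension."* (L3101), with the
  PRINTED PROOF (L3106–3137, citing Glimm–Jaffe 1987): (basic1) by counting the polymers with |X| = n through □ by
  the closed paths of length 2(n−1) over a spanning tree, (basic2) from (basic1) and *"the inequality d(X) ≥
  3^{−d}|X| − 1 quoted in (ninety)"*; App. A Corollary 26 (`\label{cranberry}`, L3140–3148), verbatim: *"Σ_{X: X∩Y≠∅} e^{−a|X|_M} ≤ b|Y|_M,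
  Σ_{X: X∩Y≠∅} e^{−κ₀d_M(X)} ≤ K₀|Y|_M"* with its proof line (L3151–3157) *"The first follows by Σ_{X: X∩Y≠∅} e^{−a|X|}
  ≤ Σ_{□⊂Y} Σ_{X⊃□} e^{−a|X|} ≤ b|Y|. The second is similar."* — and §3.3 eq. `\label{ninety}` (TeX L1344–1347), verbatim: *"Then we have the
  inequalities [Bal98b]  d_M(X) ≤ |X|_M ≤ 3^d(1 + d_M(X))"*, CITED there to T. Bałaban, *Renormalization and
  localization expansions II*, CMP 198 (1998) 1–45 (not held by the cell), NOT proved in [Dimock2013].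
* J. Dimock, *The renormalization group according to Balaban. II. Large fields*, J. Math. Phys. **54** (2013)
  092301 [`Dimock2013BalabanII`; arXiv:1212.5562v2, TeX L6776–6829] — App. E Lemma E.1 (`\label{steamy}`, L6790–6798), verbatim:
  *"1. ℓ_M(Y) ≤ 2ℓ̃_M(Y);  2. ℓ′_M(Y) ≤ ℓ_M(Y) + |Y|_M;  3. |Y|_M ≤ 4(2^d+1)(ℓ_M(Y)+1)"* for ANY finite collection Y
  of M-blocks, with (L6786–6788) *"We have trivially ℓ̃_M(Y) ≤ ℓ_M(Y) ≤ ℓ′_M(Y). If Y is connected then ℓ̃_M(Y)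
  differs slightly from d_M(Y) defined in part I, since the latter requires a minimal tree to lie in Y. But we do
  have ℓ̃_M(Y) ≤ d_M(Y)."* and the PRINTED PROOF of item 3 (L6816–6828; part 1 cited to [DIS73] L6804; sup-metric L6811) — hence, for connected Y,
  `|Y|_M ≤ 4(2^d+1)(2d_M(Y)+1) ≤ 8(2^d+1)(1 + d_M(Y))`: the PROVED published form of the volume-versus-tree-length
  inequality (constant `c₀ = 8(2^d+1)`, = 136 for d = 4; the cited [Bal98b] form has `c₀ = 3^d`).

WHAT THIS MODULE DOES (surge unit `b2b-balaban-pv03`, gen 2, 2026-08-18; v1 p176933 commit 60a0c5463046 = §§1–5, v2 p176974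
commit b3e3e589a5dd adds §6, v3 adds §7; imports `B12`, `B13FamilySum` and `Literature.Probability.LatticeModels.PolymerGasGeometric`, modifies nothing):

1. `CubeSystem S` — the localization domains of a `Setup.LocDomainSys` AS connected families of cubes: a finite
   type of cubes (`π_j`), the "common wall" adjacency with its finite neighbour lists, the (injective) map
   `X ↦ cubes X` and the printed connectedness of every domain (`IsRConnected` of the tree's polymer-gas module =
   B12 p. 257's chain condition).  `CubeSystem.toCubeCover` recovers the coarser carrier `B12.CubeCover` of T09.1
   (`above □ = {X : X ⊃ □}`).  The continuum tree length `d_j` stays ABSTRACT (`LocDomainSys.dj`, DIVERGENCE F5).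
2. The ONE geometric leaf, as a named HYPOTHESIS never asserted: `CubeSystem.VolumeLeaf c₀` =
   *"|X|_M ≤ c₀(1 + d_M(X))"* (Dimock I (ninety) with c₀ = 3^d, cited to [Bal98b]; Dimock II Lemma E.1(3)+(1) with
   c₀ = 8(2^d+1), proved in print).  NB the additive constant: the B-side prints B13 (1.28) p. 8 *"M^{−4}|Y| ≤
   3·2³d_k(Y)"* and (2.30) p. 18 WITHOUT it, which is false for a single cube (d_k = 0) — cell GAPS.md G-B13-07;
   the leaf here is the true published form.
3. KERNEL: `sum_exp_vol_le` = (basic1) with EXPLICIT constants — for every `a ≥ a₀(Δ) := log(2(Δ+1)²)` (Δ = the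
   maximal number of wall-neighbours, `2d` for `π_j`) and every cube □, `Σ_{X⊃□} exp(−a|X|) ≤ (Δ+1)^{−2}` — from the
   tree's lattice-animal count `Literature.Probability.LatticeModels.sum_pow_card_le_of_connected` (Friedli–Velenik
   (5.27)/Lemma 3.38 = Dimock's path count); `ineq126_of_volumeLeaf` = (basic2) = **(1.26)** with EXPLICIT constants
   — under `VolumeLeaf c₀`, for every `κ ≥ κ₀ := c₀·a₀(Δ)`: `Σ_{X⊃□} exp(−κ d_j(X)) ≤ K₀ := e^{κ₀}(Δ+1)^{−2}`
   (Dimock's *"provided κ₀ ≥ 3^d a and K₀ ≥ e^{κ₀} b"*), uniformly in j, □ and the lattice — the printed "O(1)".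
4. DISCHARGE of the silent input of [I] pp. 257–258: `hTree_of_volumeLeaf` produces the hypothesis `hTree` of the
   T09.1 theorems for the cover `toCubeCover`, and `uvStable030_of_thm1_of_volumeLeaf` = `B12.uvStable030_of_thm1`
   with `hTree` REPLACED by (`VolumeLeaf c₀` at every scale of every run, degree ≤ Δ, κ ≥ κ₀(c₀, Δ)) and the
   constant `O(1)·K₀(c₀,Δ)·(1 − L^{−α})^{−1}`.
5. DISCHARGE of the two quoted inputs of the family-sum module `B13FamilySum` ((2.29) of [II] p. 18, surge node
   G-B13-04-229, cell GAPS.md G-B13-04 second half): over the whole catalogue `Finset.univ` with the footprints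
   `G.cubes`, its hypotheses `B13FamilySum.Ineq126` and `B13FamilySum.VolBound` ARE `Ineq126Printed` and `VolumeLeaf`
   (`familySum_ineq126_iff`, `familySum_volBound_iff`); hence `familySum_ineq126_of_volumeLeaf` and
   `ineq229_of_volumeLeaf` = **(2.29)** `Σ_D Π_{Y∈D} α₆ exp(−δκ d_k(Y)) ≤ 1` for every `Y₀`, from the animal count and
   the SAME single leaf, for `δκ ≥ κ₀(c₀,Δ) + a₂` and `α₆ e^{a₂} K₀(c₀,Δ) c₀ ≤ a₂` (`c₀ > 0`).  After this module the two
   combinatorial inputs (1.26), (2.29) of [II] §§1–2 that the series states by reference ("see [48, 50, 40, 26, 3]",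
   "by a simple modification of the argument in [26]") rest on ONE quoted published geometric inequality.
6. (v3, §7) The corollary SHAPE of Dimock I Cor. 26 over `CubeSystem` — `sum_touches_le` (the union bound
   `Σ_{X∩Y≠∅} ≤ Σ_{□∈Y} Σ_{X⊃□}` of its proof), `sum_exp_vol_touches_le` (`Σ_{X∩Y≠∅} e^{−a|X|} ≤ (Δ+1)^{−2}·#Y`),
   `ineq126_touches` (`Σ_{X∩Y≠∅} exp(−κd_j(X)) ≤ K₀(c₀,Δ)·#Y`, modulo the leaf) — and the printed remark of [II] p. 8
   *"The number O(1) is in fact small, because we sum over X with d_j(X) ≠ 0"* QUANTIFIED in the only form a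
   combinatorial lemma can give it: `offDiag_le` — for every threshold `d₀ ≥ 0` the sub-sum of (1.26) over
   `d_j(X) ≥ d₀` is `≤ exp(−(κ − κ₀(c₀,Δ))d₀)·K₀(c₀,Δ)`, and `offDiag_le_of_gap` — the sub-sum over `d_j(X) ≠ 0` is
   `≤ exp(−(κ − κ₀(c₀,Δ)))·K₀(c₀,Δ)` GIVEN the gap hypothesis `d_j(X) ≠ 0 → d_j(X) ≥ 1` (the cube geometry of [I]
   p. 257: distinct cubes of π_j have centres ≥ M apart; supplied by name, never asserted — DIVERGENCE F5).

What is NOT here: the geometry of the torus cubes (that wall-adjacency in `π_j ⊂ T` has ≤ 2d neighbours and that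
Bałaban's `d_j` satisfies the leaf and the unit gap are the quoted inputs, by name); the words *"as it follows from
our inductive construction"* of the smallness remark (which X actually occur is a property of the expansion of [II],
not of 𝐃_j; (1.26) as displayed contains the □′-term, equal to 1, so its O(1) is ≥ 1 — §7 bounds the sub-sum only);
the MECHANISM of the family-sum bound (2.29) of [II] (module `B13FamilySum`, surge node G-B13-04-229 — §6 only
discharges its two inputs).  Value = kernel discharge of a by-reference input modulo one quoted published leaf +
typed skeleton, NOT summit progress.
-/

namespace Literature.MathematicalPhysics.QuantumFieldTheory.Balaban1983to89.B12TreeDecay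

open Literature.MathematicalPhysics.QuantumFieldTheory.Balaban1983to89
open Literature.Probability.LatticeModels (IsRConnected sum_pow_card_le_of_connected)

/-! ## 1. Localization domains as connected families of cubes -/

/-- The localization domains `𝐃_j` of one scale AS connected families of cubes of `π_j` (B12 p. 257 [9], verbatim:
*"We decompose the space T into the lattice of closed cubes of a size M … We denote this family of cubes by π_j,
and the cubes by □, □′, etc. … Such a domain is a union of a connected, finite family of cubes from π_j. A
connected family means that for every pair □, □′ of cubes from the family there exists a sequence □, □₁, …, □_n,
□′ of cubes belonging to the family and such that two consecutive cubes have a common wall, i.e. their intersection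
is a d−1-dimensional cube. The class of all these localization domains is denoted by 𝐃_j."*; identical convention
in [Dimock2013] §3.1, TeX L1163–1167 *"connected means that for any two cubes □, □′ in X there is a sequence □ = □₀,
□₁, □₂, …, □_m = □′ such that □_j ⊂ X and □_j and □_{j+1} have a (d−1) = 2 dimensional face in common"*).  Data:
the finite type of cubes, the wall-adjacency `Adj` (symmetric) with finite neighbour lists `nbr`, the cubes of each
domain (`cubes`, injective: a domain IS the union of its cubes) and the printed connectedness (`IsRConnected`:
nonempty and chain-connected inside the family).  The tree length `d_j` is the abstract `LocDomainSys.dj`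
(DIVERGENCE F5). [cite: Balaban1987RG1, §0 p.257] -/
structure CubeSystem (S : LocDomainSys) where
  /-- the cubes `□ ∈ π_j` -/
  Cube : Type
  [fin : Fintype Cube]
  [deq : DecidableEq Cube]
  /-- "two … cubes have a common wall" -/
  Adj : Cube → Cube → Prop
  adj_symm : ∀ a b, Adj a b → Adj b a
  /-- the wall-neighbours of a cube, as a finite list -/
  nbr : Cube → Finset Cube
  mem_nbr : ∀ a b, Adj a b → b ∈ nbr a
  /-- the family of cubes of a localization domain -/
  cubes : S.Dom → Finset Cube
  cubes_injective : Function.Injective cubes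
  /-- "a union of a connected, finite family of cubes" (nonempty, chain-connected through common walls) -/
  connected : ∀ X, IsRConnected Adj (cubes X)

/-- `π_j` is a finite family (B12 p. 257 [9]: the torus is compact, the cubes have size `M`); exposes the field
`CubeSystem.fin` (same pattern as `B12.CubeCover.instFintypeCube`). [cite: Balaban1987RG1, §0 p.257] -/
instance CubeSystem.instFintypeCube {S : LocDomainSys} (G : CubeSystem S) : Fintype G.Cube := G.fin

/-- Equality of cubes is decidable (cubes are indexed by their centres in the finite lattice `T^{(j+m)}_M`,
B12 p. 257 [9]); exposes the field `CubeSystem.deq`. [cite: Balaban1987RG1, §0 p.257] -/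
instance CubeSystem.instDecidableEqCube {S : LocDomainSys} (G : CubeSystem S) : DecidableEq G.Cube := G.deq

namespace CubeSystem

variable {S : LocDomainSys} (G : CubeSystem S)

/-- `{X ∈ 𝐃_j : X ⊃ □}` (B12 p. 257 [9]; B13 (1.26) "X ⊃ □′"): the domains whose family of cubes contains `□`. [cite: Balaban1987RG1, §0 p.257] -/
def above (c : G.Cube) : Finset S.Dom := Finset.univ.filter fun X => c ∈ G.cubes X

/-- Membership in `above □` is "□ is one of the cubes of X". [folklore] -/
@[simp] theorem mem_above {c : G.Cube} {X : S.Dom} : X ∈ G.above c ↔ c ∈ G.cubes X := by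
  simp [above]

/-- `|X|_M` = the number of cubes of `π_j` in `X` (= `M^{−d}|X|`; [Dimock2013] TeX L1341–1343 *"|X|_M = Vol(X)/M³ = number
of M-cubes in X"*, B13 p. 8 "M^{−4}|Y|"). [cite: Dimock2013, §3.3 (arXiv:1108.1335v2 TeX L1341–1343)] -/
def vol (X : S.Dom) : ℕ := (G.cubes X).card

/-- Every domain has at least one cube (it is a NONEMPTY family). [folklore] -/
theorem vol_pos (X : S.Dom) : 0 < G.vol X := Finset.card_pos.2 (G.connected X).1

/-- Every domain lies above some cube. [folklore] -/
theorem exists_cube (X : S.Dom) : ∃ c : G.Cube, X ∈ G.above c := by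
  obtain ⟨c, hc⟩ := (G.connected X).1
  exact ⟨c, G.mem_above.2 hc⟩

/-- The coarser carrier of surge node T09.1 (`B12.CubeCover`: cubes, `above`, every domain contains a cube) induced
by a `CubeSystem`. [folklore] -/
def toCubeCover : B12.CubeCover S where
  Cube := G.Cube
  above := G.above
  exists_cube := G.exists_cube

/-- `toCubeCover` has the same `above`. [folklore] -/
@[simp] theorem toCubeCover_above (c : G.Cube) : G.toCubeCover.above c = G.above c := rfl

/-- Degree bound: every cube has at most `Δ` wall-neighbours (for the cubes `π_j` of a d-dimensional torus,
`Δ = 2d`; [Dimock2013] L3119–3120 counts the paths *"by (2^d)^{2(n−1)}"*). A hypothesis on the geometry, by name. [folklore] -/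
def DegreeLE (Δ : ℕ) : Prop := ∀ a : G.Cube, (G.nbr a).card ≤ Δ

/-- **The quoted geometric leaf** (never asserted): *"|X|_M ≤ c₀(1 + d_M(X))"* for every localization domain —
[Dimock2013] §3.3 (ninety), TeX L1344–1347, verbatim: *"Then we have the inequalities [Bal98b]  d_M(X) ≤ |X|_M ≤
3^d(1 + d_M(X))"* (c₀ = 3^d; cited to Bałaban, CMP 198 (1998) 1–45, not proved there); PROVED published form:
[Dimock2013BalabanII] App. E Lemma E.1, TeX L6790–6798, verbatim: *"1. ℓ_M(Y) ≤ 2ℓ̃_M(Y)  2. ℓ′_M(Y) ≤ ℓ_M(Y) +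
|Y|_M  3. |Y|_M ≤ 4(2^d+1)(ℓ_M(Y)+1)"* with L6788 *"But we do have ℓ̃_M(Y) ≤ d_M(Y)"* for connected Y, whence
`|Y|_M ≤ 8(2^d+1)(1 + d_M(Y))` (c₀ = 8(2^d+1) = 136 for d = 4, sup-metric).  The B-side prints the inequality
WITHOUT the additive constant (B13 (1.28) p. 8, (2.30) p. 18) — false for a single cube, cell GAPS.md G-B13-07;
this leaf is the repaired = published form. [cite: Dimock2013BalabanII, App. E Lemma E.1 (arXiv:1212.5562v2 TeX L6790–6798)] -/
def VolumeLeaf (c₀ : ℝ) : Prop := ∀ X : S.Dom, (G.vol X : ℝ) ≤ c₀ * (1 + S.dj X)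

/-- **B13 (1.26)** p. 8 [PDF 8], verbatim: *"For the second sum we have  Σ_{X∈𝐃_j, X⊃□′} exp(−κd_j(X)) ≤ O(1),
(1.26)  for κ sufficiently large. The number O(1) is in fact small, because we sum over X with d_j(X) ≠ 0, as it
follows from our inductive construction. This inequality was used many times in convergence proofs for cluster
expansions, for example see [48, 50, 40, 26, 3]."* — typed at fixed `κ` and constant `O1` for every cube (the words
"for κ sufficiently large" and the independence of `O(1)` from j, □′ and the lattice are the quantifiers of
`ineq126_of_volumeLeaf`); the same display is [Dimock2013] Lemma 25 (basic2) and the hypothesis `hTree` of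
`B12.chain026_holds`/`chain030_holds` at one scale.  NOT asserted; PROVED below modulo `VolumeLeaf`. [cite: Balaban1988RG2Cluster, (1.26) p.8] -/
def Ineq126Printed (κ O1 : ℝ) : Prop :=
  ∀ c : G.Cube, ∑ X ∈ G.above c, Real.exp (-κ * S.dj X) ≤ O1

end CubeSystem

/-! ## 2. The explicit constants -/

/-- `a₀(Δ) = log(2(Δ+1)²)`: the volume decay rate at which the animal sum converges ((Δ+1)²e^{−a₀} = ½; [Dimock2013]
L3127 *"provided a > 2d log 2"*). [cite: Dimock2013, App. A Lemma 25 proof (arXiv:1108.1335v2 TeX L3106–3127)] -/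
noncomputable def a₀ (Δ : ℕ) : ℝ := Real.log (2 * ((Δ : ℝ) + 1) ^ 2)

/-- `κ₀(c₀, Δ) = c₀ · a₀(Δ)` ([Dimock2013] L3136 *"provided κ₀ ≥ 3^d a"*, 3^d ↦ c₀). [cite: Dimock2013, App. A Lemma 25 proof (arXiv:1108.1335v2 TeX L3128–3136)] -/
noncomputable def kappa₀ (c₀ : ℝ) (Δ : ℕ) : ℝ := c₀ * a₀ Δ

/-- `K₀(c₀, Δ) = e^{κ₀}(Δ+1)^{−2}` ([Dimock2013] L3136 *"and K₀ ≥ e^{κ₀} b"*, b = 2e^{−a₀} = (Δ+1)^{−2}). [cite: Dimock2013, App. A Lemma 25 proof (arXiv:1108.1335v2 TeX L3128–3136)] -/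
noncomputable def K₀ (c₀ : ℝ) (Δ : ℕ) : ℝ := Real.exp (kappa₀ c₀ Δ) / ((Δ : ℝ) + 1) ^ 2

/-- `a₀ ≥ 0` (as `2(Δ+1)² ≥ 1`). [folklore] -/
theorem a₀_nonneg (Δ : ℕ) : 0 ≤ a₀ Δ := by
  unfold a₀
  apply Real.log_nonneg
  have : (0 : ℝ) ≤ (Δ : ℝ) := Nat.cast_nonneg _
  nlinarith

/-- `e^{−a₀} = 1/(2(Δ+1)²)`. [folklore] -/
theorem exp_neg_a₀ (Δ : ℕ) : Real.exp (-a₀ Δ) = 1 / (2 * ((Δ : ℝ) + 1) ^ 2) := by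
  have hpos : (0 : ℝ) < 2 * ((Δ : ℝ) + 1) ^ 2 := by positivity
  rw [a₀, Real.exp_neg, Real.exp_log hpos, one_div]

/-- The smallness condition of the animal sum holds with EQUALITY at `a₀`: `(Δ+1)² e^{−a₀} = ½`. [folklore] -/
theorem smallness_a₀ (Δ : ℕ) : ((Δ : ℝ) + 1) ^ 2 * Real.exp (-a₀ Δ) ≤ 1 / 2 := by
  have hpos : (0 : ℝ) < ((Δ : ℝ) + 1) ^ 2 := by positivity
  rw [exp_neg_a₀]
  rw [show ((Δ : ℝ) + 1) ^ 2 * (1 / (2 * ((Δ : ℝ) + 1) ^ 2)) = 1 / 2 by field_simp]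

/-- `κ₀ ≥ 0` for `c₀ ≥ 0`. [folklore] -/
theorem kappa₀_nonneg {c₀ : ℝ} (hc₀ : 0 ≤ c₀) (Δ : ℕ) : 0 ≤ kappa₀ c₀ Δ :=
  mul_nonneg hc₀ (a₀_nonneg Δ)

/-- `K₀ > 0`. [folklore] -/
theorem K₀_pos (c₀ : ℝ) (Δ : ℕ) : 0 < K₀ c₀ Δ := by
  unfold K₀; positivity

/-! ## 3. (basic1): the animal sum with volume decay, from the tree's lattice-animal count -/

/-- **[Dimock2013] Lemma 25 (basic1), kernel-checked with explicit constants**: if every cube has at most `Δ`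
wall-neighbours, then for every `a ≥ a₀(Δ) = log(2(Δ+1)²)` and every cube □,
`Σ_{X∈𝐃_j, X⊃□} exp(−a|X|) ≤ (Δ+1)^{−2}` (`≤ b`).  Printed proof (TeX L3106–3127): count the domains with |X| = n
through □ by closed paths of length 2(n−1) — here the tree's `sum_pow_card_le_of_connected` (Friedli–Velenik (5.27)
with Lemma 3.38: at most (Δ+1)^{2m} connected (m+1)-sets through a vertex, then a geometric series), applied to the
injective image `X ↦ cubes X` with `λ = e^{−a₀}`, and monotonicity in `a`. [cite: Dimock2013, App. A Lemma 25(1) (arXiv:1108.1335v2 TeX L3080–3127)] -/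
theorem sum_exp_vol_le {S : LocDomainSys} (G : CubeSystem S) {Δ : ℕ} (hΔ : G.DegreeLE Δ)
    {a : ℝ} (ha : a₀ Δ ≤ a) (c : G.Cube) :
    ∑ X ∈ G.above c, Real.exp (-a * (G.vol X : ℝ)) ≤ 1 / ((Δ : ℝ) + 1) ^ 2 := by
  classical
  -- monotonicity in `a` and `exp(−a₀ n) = (e^{−a₀})^n`
  have hmono : ∀ X ∈ G.above c,
      Real.exp (-a * (G.vol X : ℝ)) ≤ Real.exp (-a₀ Δ) ^ (G.cubes X).card := by
    intro X _
    rw [← Real.exp_nat_mul]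
    apply Real.exp_le_exp.2
    have h0 : (0 : ℝ) ≤ (G.vol X : ℝ) := Nat.cast_nonneg _
    have : ((G.cubes X).card : ℝ) = (G.vol X : ℝ) := rfl
    rw [this]
    nlinarith
  refine (Finset.sum_le_sum hmono).trans ?_
  -- re-index over the (injective) image `X ↦ cubes X`
  have hinj : Set.InjOn G.cubes ↑(G.above c) := G.cubes_injective.injOn
  rw [← Finset.sum_image (f := fun Y : Finset G.Cube => Real.exp (-a₀ Δ) ^ Y.card) hinj]
  have h := sum_pow_card_le_of_connected (R := G.Adj) (nbr := G.nbr) (Δ := Δ) G.adj_symm hΔ G.mem_nbr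
    (Real.exp_nonneg _) (smallness_a₀ Δ) c ((G.above c).image G.cubes) (fun Y hY => by
      obtain ⟨X, hX, rfl⟩ := Finset.mem_image.1 hY
      exact ⟨G.mem_above.1 hX, G.connected X⟩)
  refine h.trans (le_of_eq ?_)
  rw [exp_neg_a₀]
  have hpos : (0 : ℝ) < ((Δ : ℝ) + 1) ^ 2 := by positivity
  field_simp

/-! ## 4. (basic2) = (1.26): tree-length decay, modulo the volume leaf -/

/-- Term-wise comparison ([Dimock2013] L3128–3134 *"We use the inequality d(X) ≥ 3^{−d}|X| − 1 … Therefore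
Σ exp(−κ₀ d(X)) ≤ e^{κ₀} Σ exp(−3^{−d}κ₀|X|)"*): under `VolumeLeaf c₀` and `κ ≥ κ₀ = c₀a₀`,
`exp(−κ d_j(X)) ≤ e^{κ₀} · exp(−a₀|X|)` (uses `d_j ≥ 0`, `Setup.LocDomainSys.dj_nonneg`; no sign condition on `c₀`). [cite: Dimock2013, App. A Lemma 25(2) proof (arXiv:1108.1335v2 TeX L3128–3136)] -/
theorem exp_tree_le_exp_vol {S : LocDomainSys} (G : CubeSystem S) {Δ : ℕ} {c₀ : ℝ}
    (hV : G.VolumeLeaf c₀) {κ : ℝ} (hκ : kappa₀ c₀ Δ ≤ κ) (X : S.Dom) :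
    Real.exp (-κ * S.dj X) ≤ Real.exp (kappa₀ c₀ Δ) * Real.exp (-a₀ Δ * (G.vol X : ℝ)) := by
  rw [← Real.exp_add]
  apply Real.exp_le_exp.2
  have hd : 0 ≤ S.dj X := S.dj_nonneg X
  have hv : (G.vol X : ℝ) ≤ c₀ * (1 + S.dj X) := hV X
  have ha : 0 ≤ a₀ Δ := a₀_nonneg Δ
  have h1 : a₀ Δ * (G.vol X : ℝ) ≤ a₀ Δ * (c₀ * (1 + S.dj X)) := mul_le_mul_of_nonneg_left hv ha
  have h2 : kappa₀ c₀ Δ * S.dj X ≤ κ * S.dj X := mul_le_mul_of_nonneg_right hκ hd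
  unfold kappa₀ at h2 ⊢
  nlinarith

/-- **B13 (1.26) = [Dimock2013] Lemma 25 (basic2), kernel-checked modulo the volume leaf, with explicit
constants**: if every cube has at most `Δ` wall-neighbours and `|X| ≤ c₀(1 + d_j(X))` for all domains (no sign
condition on `c₀` is needed: for `c₀ ≤ 0` the leaf is unsatisfiable as soon as a domain exists), then for EVERY `κ ≥ κ₀(c₀,Δ) = c₀ log(2(Δ+1)²)` and every cube □′:
`Σ_{X∈𝐃_j, X⊃□′} exp(−κ d_j(X)) ≤ K₀(c₀,Δ) = e^{κ₀}(Δ+1)^{−2}` — "≤ O(1) for κ sufficiently large", the O(1)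
depending on (c₀, Δ) = the dimension only ([Dimock2013] L3101 *"The constants depend only on the dimension"*).
Proof as printed (L3128–3136): `exp_tree_le_exp_vol` term by term, then (basic1) = `sum_exp_vol_le` at `a₀`. [cite: Balaban1988RG2Cluster, (1.26) p.8] -/
theorem ineq126_of_volumeLeaf {S : LocDomainSys} (G : CubeSystem S) {Δ : ℕ} (hΔ : G.DegreeLE Δ)
    {c₀ : ℝ} (hV : G.VolumeLeaf c₀) {κ : ℝ} (hκ : kappa₀ c₀ Δ ≤ κ) :
    G.Ineq126Printed κ (K₀ c₀ Δ) := by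
  intro c
  calc ∑ X ∈ G.above c, Real.exp (-κ * S.dj X)
      ≤ ∑ X ∈ G.above c, Real.exp (kappa₀ c₀ Δ) * Real.exp (-a₀ Δ * (G.vol X : ℝ)) :=
        Finset.sum_le_sum fun X _ => exp_tree_le_exp_vol G hV hκ X
    _ = Real.exp (kappa₀ c₀ Δ) * ∑ X ∈ G.above c, Real.exp (-a₀ Δ * (G.vol X : ℝ)) :=
        (Finset.mul_sum _ _ _).symm
    _ ≤ Real.exp (kappa₀ c₀ Δ) * (1 / ((Δ : ℝ) + 1) ^ 2) :=
        mul_le_mul_of_nonneg_left (sum_exp_vol_le G hΔ le_rfl c) (Real.exp_nonneg _)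
    _ = K₀ c₀ Δ := by rw [K₀]; ring

/-- The "for κ sufficiently large … ≤ O(1)" quantifier shape of (1.26), literally: under the leaf there EXIST
`κ₀` and `O1 > 0` (depending on `c₀`, `Δ` only) with the bound for all `κ ≥ κ₀` and all cubes. [cite: Balaban1988RG2Cluster, (1.26) p.8] -/
theorem ineq126_eventually {S : LocDomainSys} (G : CubeSystem S) {Δ : ℕ} (hΔ : G.DegreeLE Δ)
    {c₀ : ℝ} (hV : G.VolumeLeaf c₀) :
    ∃ κ₀ O1 : ℝ, 0 < O1 ∧ ∀ κ, κ₀ ≤ κ → G.Ineq126Printed κ O1 :=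
  ⟨kappa₀ c₀ Δ, K₀ c₀ Δ, K₀_pos c₀ Δ, fun _ hκ => ineq126_of_volumeLeaf G hΔ hV hκ⟩

/-! ## 5. Discharge of the silent input `hTree` of [I] (0.26)/(0.30) (surge node T09.1) -/

/-- The hypothesis `hTree` of `B12.chain026_holds` / `B12.chain030_holds` at one scale, for the cover induced by a
`CubeSystem`, DISCHARGED modulo the volume leaf: `∀ □, Σ_{X ∈ above □} exp(−κ d_j(X)) ≤ K₀(c₀,Δ)` for
`κ ≥ κ₀(c₀,Δ)`. [cite: Balaban1987RG1, (0.26) p.257 and (0.30) p.258] -/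
theorem hTree_of_volumeLeaf {S : LocDomainSys} (G : CubeSystem S) {Δ : ℕ} (hΔ : G.DegreeLE Δ)
    {c₀ : ℝ} (hV : G.VolumeLeaf c₀) {κ : ℝ} (hκ : kappa₀ c₀ Δ ≤ κ) :
    ∀ c : G.toCubeCover.Cube, ∑ X ∈ G.toCubeCover.above c, Real.exp (-κ * S.dj X) ≤ K₀ c₀ Δ :=
  ineq126_of_volumeLeaf G hΔ hV hκ

/-- The multi-scale form consumed by `B12.chain026_holds` / `B12.chain030_holds` (`∀ j ∈ [1,k], ∀ □ ∈ π_j, …`):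
one `CubeSystem` per scale, the leaf and the degree bound at every scale with the SAME `c₀`, `Δ` (dimension-only
constants), `κ ≥ κ₀(c₀,Δ)`. [cite: Balaban1987RG1, (0.26) p.257 and (0.30) p.258] -/
theorem hTree_scales_of_volumeLeaf (k : ℕ) (S : ℕ → LocDomainSys) (G : (j : ℕ) → CubeSystem (S j)) {Δ : ℕ}
    (hΔ : ∀ j, (G j).DegreeLE Δ) {c₀ : ℝ} (hV : ∀ j, (G j).VolumeLeaf c₀) {κ : ℝ}
    (hκ : kappa₀ c₀ Δ ≤ κ) :
    ∀ j ∈ Finset.Icc 1 k, ∀ c : (G j).toCubeCover.Cube,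
      ∑ X ∈ (G j).toCubeCover.above c, Real.exp (-κ * (S j).dj X) ≤ K₀ c₀ Δ :=
  fun j _ => hTree_of_volumeLeaf (G j) (hΔ j) (hV j) hκ

/-- **`B12.uvStable030_of_thm1` with the tree-decay input DISCHARGED** (p. 258 [10] *"These inequalities yield a
uniform bound of the sum (0.23) on the lattice T_η"*; p. 259 [11]): Theorem 1 (`B12.Thm1Printed`) ⟹ ultraviolet
stability (0.30) (`B12.UVStable030`) with the constant `O(1)·K₀(c₀,Δ)·(1 − L^{−α})^{−1}`, where the former
hypothesis `hTree` (silent input (a) of T09.1, cell GAPS.md G-pv03-1) is REPLACED by: the localization domains of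
every scale of every run form connected families of cubes (`G P j : CubeSystem`), every cube has at most `Δ`
wall-neighbours, the volume leaf holds with one constant `c₀`, and `κ ≥ κ₀(c₀,Δ)`; the remaining displayed inputs
(`h023`, `h028`, `h029` = the reading of `Repr`; `hπ`, `hSites` = cube/site counts) are as in T09.1.  Pure
composition of `B12.uvStable030_of_thm1` with `hTree_of_volumeLeaf`. [cite: Balaban1987RG1, (0.30) p.258 and p.259] -/
theorem uvStable030_of_thm1_of_volumeLeaf (C : B12.Construction) (O1 α κ M L c₀ : ℝ) (Δ : ℕ)
    (hO1 : 0 ≤ O1) (hα : 0 < α) (hM : 0 < M) (hL : 1 < L) (hκ : kappa₀ c₀ Δ ≤ κ)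
    (S : B12.RunParams → ℕ → LocDomainSys) (G : (P : B12.RunParams) → (j : ℕ) → CubeSystem (S P j))
    (hΔ : ∀ P j, (G P j).DegreeLE Δ) (hV : ∀ P j, (G P j).VolumeLeaf c₀)
    (Etot : (P : B12.RunParams) → (k : ℕ) → (C P).Cfg k → ℕ → ℝ)
    (VX : (P : B12.RunParams) → (k : ℕ) → (C P).Cfg k → (j : ℕ) → (S P j).Dom → ℝ)
    (h1 : B12.Thm1Printed C)
    (h023 : ∀ P k, (C P).Repr k → ∀ V, V ∈ (C P).dom k →
      B12.Sum023Printed ((C P).Ek k V) ((C P).wilsonBG k V) (fun j => (C P).flow.β j ((C P).flow.g (j - 1)))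
        (Etot P k V) k)
    (h028 : ∀ P k, (C P).Repr k → ∀ V, V ∈ (C P).dom k → ∀ j ∈ Finset.Icc 1 k,
      B12.Sum028Printed ((C P).flow.β j ((C P).flow.g (j - 1))) ((C P).wilsonBG k V) (Etot P k V j) (VX P k V j))
    (h029 : ∀ P k, (C P).Repr k → ∀ V, V ∈ (C P).dom k → ∀ j ∈ Finset.Icc 1 k,
      B12.Bound029Printed (VX P k V j) O1 L ((L ^ k)⁻¹) α κ j)
    (hπ : ∀ P j, (Fintype.card (G P j).Cube : ℝ) = M⁻¹ ^ 4 * ((C P).numSites j : ℝ))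
    (hSites : ∀ P j k, j ≤ k → k ≤ P.K →
      ((C P).numSites j : ℝ) = (L ^ (k - j)) ^ 4 * ((C P).numSites k : ℝ)) :
    ∃ γ : ℝ, 0 < γ ∧ B12.UVStable030 C γ (O1 * K₀ c₀ Δ * (1 - L ^ (-α))⁻¹) M :=
  B12.uvStable030_of_thm1 C O1 α κ (K₀ c₀ Δ) M L hO1 hα (K₀_pos c₀ Δ).le hM hL S
    (fun P j => (G P j).toCubeCover) Etot VX h1 h023 h028 h029
    (fun P j => hTree_of_volumeLeaf (G P j) (hΔ P j) (hV P j) hκ) hπ hSites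

/-! ## 6. Discharge of the hypotheses `Ineq126`, `VolBound` of the family-sum module `B13FamilySum` ((2.29) of [II]) -/

/-- The (1.26)-hypothesis of `B13FamilySum` (typed there over an abstract catalogue `S` with footprints `cubes`,
verbatim docstring *"Σ_{X∈D_j, X⊃□′} exp(−κ d_j(X)) ≤ O(1), (1.26) for κ sufficiently large"*), taken over the
whole class `𝐃_j = Finset.univ` with the footprints of a `CubeSystem`, IS `Ineq126Printed` (same cubes, same sum;
`-(κ·d)` versus `(-κ)·d`). [cite: Balaban1988RG2Cluster, (1.26) p.8] -/
theorem familySum_ineq126_iff {S : LocDomainSys} (G : CubeSystem S) (κ O1 : ℝ) :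
    B13FamilySum.Ineq126 (Finset.univ : Finset S.Dom) G.cubes S.dj κ O1 ↔ G.Ineq126Printed κ O1 := by
  simp only [B13FamilySum.Ineq126, CubeSystem.Ineq126Printed, CubeSystem.above, neg_mul]

/-- The additive volume hypothesis `VolBound` of `B13FamilySum` (*"|Y| ≤ c₁(1 + d_k(Y))"*, the repaired form of
B13 (2.30) p. 18 lower half, cell GAPS.md G-B13-07) over the whole class IS the leaf `VolumeLeaf c₁`. [cite: Balaban1988RG2Cluster, (2.30) p.18] -/
theorem familySum_volBound_iff {S : LocDomainSys} (G : CubeSystem S) (c₁ : ℝ) :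
    B13FamilySum.VolBound (Finset.univ : Finset S.Dom) G.cubes S.dj c₁ ↔ G.VolumeLeaf c₁ := by
  simp only [B13FamilySum.VolBound, CubeSystem.VolumeLeaf, CubeSystem.vol, Finset.mem_univ, true_implies]

/-- **The (1.26)-input of (2.29) DISCHARGED** modulo the leaf: under `DegreeLE Δ`, `VolumeLeaf c₀` and
`κ ≥ κ₀(c₀,Δ)`, the hypothesis `h126 : B13FamilySum.Ineq126 univ cubes d_k κ K₀` of `B13FamilySum.ineq229` /
`ineq229_locDomainSys` holds with `K₀ = K₀(c₀,Δ)`. [cite: Balaban1988RG2Cluster, (1.26) p.8] -/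
theorem familySum_ineq126_of_volumeLeaf {S : LocDomainSys} (G : CubeSystem S) {Δ : ℕ} (hΔ : G.DegreeLE Δ)
    {c₀ : ℝ} (hV : G.VolumeLeaf c₀) {κ : ℝ} (hκ : kappa₀ c₀ Δ ≤ κ) :
    B13FamilySum.Ineq126 (Finset.univ : Finset S.Dom) G.cubes S.dj κ (K₀ c₀ Δ) :=
  (familySum_ineq126_iff G κ _).2 (ineq126_of_volumeLeaf G hΔ hV hκ)

/-- **B13 (2.29) p. 18 from the animal count and the ONE leaf**, verbatim: *"For κ sufficiently large and α₆
sufficiently small we have  Σ_D Π_{Y∈D} α₆ exp(−δκ d_k(Y)) ≤ 1.  (2.29)"* (the sum over the families D of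
different localization domains with ∪_{Y∈D} Y = Y₀; printed justification *"Inequalities of this type were
proved many times, the above can be proved, for example, by a simple modification of the argument in [26]"*, cell
GAPS.md G-B13-04 second half) — for the whole class `𝐃_k` of a `CubeSystem` and EVERY `Y₀`, with explicit
sufficient conditions: degree `≤ Δ`, the leaf `VolumeLeaf c₀` (`c₀ > 0`), `α₆ ≥ 0`, `a₂ ≥ 0`,
`δκ ≥ κ₀(c₀,Δ) + a₂` and `α₆ e^{a₂} K₀(c₀,Δ) c₀ ≤ a₂`.  Composition of `B13FamilySum.ineq229_locDomainSys` (seat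
pv18's kernel: sum over covering families ≤ Π(1 + ·) ≤ exp Σ, per-cube (1.26), rate shift) with
`familySum_ineq126_of_volumeLeaf`, `familySum_volBound_iff` and the nonemptiness of every family of cubes. [cite: Balaban1988RG2Cluster, (2.29) p.18] -/
theorem ineq229_of_volumeLeaf {S : LocDomainSys} (G : CubeSystem S) {Δ : ℕ} (hΔ : G.DegreeLE Δ)
    {c₀ : ℝ} (hc₀ : 0 < c₀) (hV : G.VolumeLeaf c₀) (δ κ α₆ a₂ : ℝ) (hα₆ : 0 ≤ α₆) (ha₂ : 0 ≤ a₂)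
    (hκ : kappa₀ c₀ Δ + a₂ ≤ δ * κ) (hsmall : α₆ * Real.exp a₂ * K₀ c₀ Δ * c₀ ≤ a₂) :
    B13FamilySum.Ineq229 (Finset.univ : Finset S.Dom) G.cubes S.dj α₆ (δ * κ) :=
  B13FamilySum.ineq229_locDomainSys S G.cubes (kappa₀ c₀ Δ) (K₀ c₀ Δ) c₀ δ κ α₆ a₂
    (fun Y => (G.connected Y).1) ((familySum_volBound_iff G c₀).2 hV)
    (familySum_ineq126_of_volumeLeaf G hΔ hV le_rfl) hα₆ ha₂ hc₀ hκ hsmall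

/-- The unit instance (`a₂ = 1`, `B13FamilySum.ineq229_unit`'s census shape): `δκ ≥ κ₀(c₀,Δ) + 1` and
`e · K₀(c₀,Δ) · c₀ · α₆ ≤ 1` give (2.29) — "κ sufficiently large and α₆ sufficiently small", both thresholds
depending on (c₀, Δ) = the dimension only. [cite: Balaban1988RG2Cluster, (2.29) p.18] -/
theorem ineq229_of_volumeLeaf_unit {S : LocDomainSys} (G : CubeSystem S) {Δ : ℕ} (hΔ : G.DegreeLE Δ)
    {c₀ : ℝ} (hc₀ : 0 < c₀) (hV : G.VolumeLeaf c₀) (δ κ α₆ : ℝ) (hα₆ : 0 ≤ α₆)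
    (hκ : kappa₀ c₀ Δ + 1 ≤ δ * κ) (hsmall : Real.exp 1 * K₀ c₀ Δ * c₀ * α₆ ≤ 1) :
    B13FamilySum.Ineq229 (Finset.univ : Finset S.Dom) G.cubes S.dj α₆ (δ * κ) :=
  ineq229_of_volumeLeaf G hΔ hc₀ hV δ κ α₆ 1 hα₆ zero_le_one hκ (by linarith)

/-! ## 7. (v3) The corollary shape "X ∩ Y ≠ ∅" (Dimock I Cor. 26) and the printed remark "O(1) is in fact small"

Comparison template ONLY (a published, proved statement whose SHAPE is typed here over `CubeSystem`; nothing of it is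
asserted): J. Dimock, *The renormalization group according to Bałaban I. Small fields*, Rev. Math. Phys. **25** (2013)
1330010, arXiv:1108.1335, App. A Corollary 26 (TeX label `cranberry`, ll. 3140–3148), verbatim:
*"Σ_{X: X∩Y≠∅} e^{−a|X|_M} ≤ b|Y|_M,  Σ_{X: X∩Y≠∅} e^{−κ₀d_M(X)} ≤ K₀|Y|_M"*, proof ll. 3151–3157, verbatim: *"Again it
suffices to take M=1. The first follows by Σ_{X: X∩Y≠∅} e^{−a|X|} ≤ Σ_{□⊂Y} Σ_{X⊃□} e^{−a|X|} ≤ b|Y|. The second is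
similar."*  Below: the union bound of that proof line (`sum_touches_le`), then both lines of the corollary with the
explicit constants of §§3–4 (`b = (Δ+1)^{−2}` for `a ≥ a₀(Δ)`; `K₀ = K₀(c₀,Δ)` for `κ ≥ κ₀(c₀,Δ)`, modulo the leaf
`VolumeLeaf c₀`).  Finally `offDiag_le`: the sentence of [II] p. 8 [PDF 8] after (1.26), verbatim *"The number O(1) is
in fact small, because we sum over X with d_j(X) ≠ 0, as it follows from our inductive construction."*, in the only
form a combinatorial lemma can give it — for every threshold `d₀ ≥ 0` the sub-sum over the domains `X ∋ □` with
`d_j(X) ≥ d₀` is at most `exp(−(κ − κ₀)d₀)·K₀`, i.e. exponentially small in `κ − κ₀`; that "d_j(X) ≠ 0" forces a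
UNIFORM gap `d_j(X) ≥ d₀ > 0` (in the cube geometry of [I] p. 257 two distinct cubes of π_j have centres at
sup-distance ≥ M, so d_j(X) ≥ 1 unless X is a single cube) is geometry NOT modelled here (cell DIVERGENCE F5): `d₀` is a
parameter, no gap is asserted. -/

/-- The union bound of Dimock I Cor. 26's proof (*"Σ_{X: X∩Y≠∅} … ≤ Σ_{□⊂Y} Σ_{X⊃□} …"*), for any nonnegative
weight: a sum over the domains whose cube family MEETS a finite set `Y` of cubes is at most the sum over `□ ∈ Y` of the
sums over the domains containing `□`.  Finite sums. [folklore] -/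
theorem sum_touches_le {S : LocDomainSys} (G : CubeSystem S) (Y : Finset G.Cube) (f : S.Dom → ℝ)
    (hf : ∀ X, 0 ≤ f X) :
    ∑ X ∈ Finset.univ.filter (fun X => (G.cubes X ∩ Y).Nonempty), f X ≤ ∑ c ∈ Y, ∑ X ∈ G.above c, f X := by
  classical
  have key : ∀ X ∈ Finset.univ.filter (fun X => (G.cubes X ∩ Y).Nonempty),
      f X ≤ ∑ c ∈ Y, (if X ∈ G.above c then f X else 0) := by
    intro X hX
    obtain ⟨c, hc⟩ := (Finset.mem_filter.1 hX).2
    rw [Finset.mem_inter] at hc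
    have hXc : X ∈ G.above c := G.mem_above.2 hc.1
    calc f X = (if X ∈ G.above c then f X else 0) := by rw [if_pos hXc]
      _ ≤ ∑ c ∈ Y, (if X ∈ G.above c then f X else 0) :=
          Finset.single_le_sum (f := fun c => if X ∈ G.above c then f X else 0)
            (fun c _ => by split_ifs <;> simp [hf X]) hc.2
  calc ∑ X ∈ Finset.univ.filter (fun X => (G.cubes X ∩ Y).Nonempty), f X
      ≤ ∑ X ∈ Finset.univ.filter (fun X => (G.cubes X ∩ Y).Nonempty),
          ∑ c ∈ Y, (if X ∈ G.above c then f X else 0) := Finset.sum_le_sum key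
    _ ≤ ∑ X, ∑ c ∈ Y, (if X ∈ G.above c then f X else 0) :=
        Finset.sum_le_univ_sum_of_nonneg fun X =>
          Finset.sum_nonneg fun c _ => by split_ifs <;> simp [hf X]
    _ = ∑ c ∈ Y, ∑ X, (if X ∈ G.above c then f X else 0) := Finset.sum_comm
    _ = ∑ c ∈ Y, ∑ X ∈ G.above c, f X :=
        Finset.sum_congr rfl fun c _ => Finset.sum_ite_mem_eq (G.above c) f

/-- Dimock I Cor. 26, FIRST line (*"Σ_{X: X∩Y≠∅} e^{−a|X|_M} ≤ b|Y|_M"*) with the explicit constants of §3: degree ≤ Δ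
and `a ≥ a₀(Δ)` give `Σ_{X ∩ Y ≠ ∅} e^{−a|X|} ≤ (Δ+1)^{−2}·#Y`.  Kernel-checked from `sum_touches_le` + `sum_exp_vol_le`.
[cite: Dimock2013, App. A Cor. 26 (arXiv:1108.1335v2 TeX L3140–3157)] -/
theorem sum_exp_vol_touches_le {S : LocDomainSys} (G : CubeSystem S) {Δ : ℕ} (hΔ : G.DegreeLE Δ)
    {a : ℝ} (ha : a₀ Δ ≤ a) (Y : Finset G.Cube) :
    ∑ X ∈ Finset.univ.filter (fun X => (G.cubes X ∩ Y).Nonempty), Real.exp (-a * (G.vol X : ℝ))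
      ≤ 1 / ((Δ : ℝ) + 1) ^ 2 * Y.card := by
  calc ∑ X ∈ Finset.univ.filter (fun X => (G.cubes X ∩ Y).Nonempty), Real.exp (-a * (G.vol X : ℝ))
      ≤ ∑ c ∈ Y, ∑ X ∈ G.above c, Real.exp (-a * (G.vol X : ℝ)) :=
        sum_touches_le G Y _ fun X => Real.exp_nonneg _
    _ ≤ ∑ _c ∈ Y, 1 / ((Δ : ℝ) + 1) ^ 2 := Finset.sum_le_sum fun c _ => sum_exp_vol_le G hΔ ha c
    _ = 1 / ((Δ : ℝ) + 1) ^ 2 * Y.card := by rw [Finset.sum_const, nsmul_eq_mul]; ring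

/-- Dimock I Cor. 26, SECOND line (*"Σ_{X: X∩Y≠∅} e^{−κ₀d_M(X)} ≤ K₀|Y|_M"*) with the explicit constants of §4 and
modulo the volume leaf: degree ≤ Δ, `VolumeLeaf c₀` and `κ ≥ κ₀(c₀,Δ)` give
`Σ_{X ∩ Y ≠ ∅} exp(−κ d_j(X)) ≤ K₀(c₀,Δ)·#Y`.  Kernel-checked from `sum_touches_le` + `ineq126_of_volumeLeaf` ((1.26)).
[cite: Dimock2013, App. A Cor. 26 (arXiv:1108.1335v2 TeX L3140–3157)] -/
theorem ineq126_touches {S : LocDomainSys} (G : CubeSystem S) {Δ : ℕ} (hΔ : G.DegreeLE Δ)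
    {c₀ : ℝ} (hV : G.VolumeLeaf c₀) {κ : ℝ} (hκ : kappa₀ c₀ Δ ≤ κ) (Y : Finset G.Cube) :
    ∑ X ∈ Finset.univ.filter (fun X => (G.cubes X ∩ Y).Nonempty), Real.exp (-κ * S.dj X)
      ≤ K₀ c₀ Δ * Y.card := by
  calc ∑ X ∈ Finset.univ.filter (fun X => (G.cubes X ∩ Y).Nonempty), Real.exp (-κ * S.dj X)
      ≤ ∑ c ∈ Y, ∑ X ∈ G.above c, Real.exp (-κ * S.dj X) :=
        sum_touches_le G Y _ fun X => Real.exp_nonneg _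
    _ ≤ ∑ _c ∈ Y, K₀ c₀ Δ := Finset.sum_le_sum fun c _ => ineq126_of_volumeLeaf G hΔ hV hκ c
    _ = K₀ c₀ Δ * Y.card := by rw [Finset.sum_const, nsmul_eq_mul]; ring

/-- Termwise splitting of the decay above a threshold: for `κ₀ ≤ κ` and `0 ≤ d₀ ≤ d`,
`exp(−κd) ≤ exp(−(κ−κ₀)d₀)·exp(−κ₀d)`.  Real arithmetic. [folklore] -/
theorem exp_split_of_le {κ₀ κ d₀ d : ℝ} (hκ : κ₀ ≤ κ) (hd : d₀ ≤ d) :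
    Real.exp (-κ * d) ≤ Real.exp (-(κ - κ₀) * d₀) * Real.exp (-κ₀ * d) := by
  rw [← Real.exp_add]
  exact Real.exp_le_exp.2 (by nlinarith [mul_le_mul_of_nonneg_left hd (sub_nonneg.2 hκ)])

/-- [II] p. 8 [PDF 8], the sentence after (1.26), verbatim: *"The number O(1) is in fact small, because we sum over X
with d_j(X) ≠ 0, as it follows from our inductive construction."* — quantified in the form a combinatorial lemma can
deliver: under degree ≤ Δ and `VolumeLeaf c₀`, for every `κ ≥ κ₀(c₀,Δ)`, every cube `□` and every threshold `d₀`
the SUB-SUM of (1.26) over the domains `X ∋ □` with `d_j(X) ≥ d₀` is at most `exp(−(κ − κ₀(c₀,Δ))·d₀)·K₀(c₀,Δ)`, i.e.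
exponentially small as κ grows when `d₀ > 0`.  The uniform gap `d₀ > 0` behind "d_j(X) ≠ 0" (two distinct cubes of π_j have centres
≥ M apart, so d_j(X) ≥ 1 for every X other than a single cube — [I] p. 257 geometry) is NOT modelled (DIVERGENCE F5):
`d₀` is a free parameter and nothing about it is asserted.  Kernel-checked from `exp_split_of_le` and (1.26) at
`κ = κ₀(c₀,Δ)`. [cite: Balaban1988RG2Cluster, (1.26) p.8] -/
theorem offDiag_le {S : LocDomainSys} (G : CubeSystem S) {Δ : ℕ} (hΔ : G.DegreeLE Δ)
    {c₀ : ℝ} (hV : G.VolumeLeaf c₀) {κ : ℝ} (hκ : kappa₀ c₀ Δ ≤ κ) (c : G.Cube) (d₀ : ℝ) :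
    ∑ X ∈ (G.above c).filter (fun X => d₀ ≤ S.dj X), Real.exp (-κ * S.dj X)
      ≤ Real.exp (-(κ - kappa₀ c₀ Δ) * d₀) * K₀ c₀ Δ := by
  calc ∑ X ∈ (G.above c).filter (fun X => d₀ ≤ S.dj X), Real.exp (-κ * S.dj X)
      ≤ ∑ X ∈ (G.above c).filter (fun X => d₀ ≤ S.dj X),
          Real.exp (-(κ - kappa₀ c₀ Δ) * d₀) * Real.exp (-kappa₀ c₀ Δ * S.dj X) :=
        Finset.sum_le_sum fun X hX => exp_split_of_le hκ (Finset.mem_filter.1 hX).2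
    _ = Real.exp (-(κ - kappa₀ c₀ Δ) * d₀) *
          ∑ X ∈ (G.above c).filter (fun X => d₀ ≤ S.dj X), Real.exp (-kappa₀ c₀ Δ * S.dj X) :=
        (Finset.mul_sum _ _ _).symm
    _ ≤ Real.exp (-(κ - kappa₀ c₀ Δ) * d₀) * ∑ X ∈ G.above c, Real.exp (-kappa₀ c₀ Δ * S.dj X) :=
        mul_le_mul_of_nonneg_left
          (Finset.sum_le_sum_of_subset_of_nonneg (Finset.filter_subset _ _)
            fun X _ _ => Real.exp_nonneg _) (Real.exp_nonneg _)
    _ ≤ Real.exp (-(κ - kappa₀ c₀ Δ) * d₀) * K₀ c₀ Δ :=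
        mul_le_mul_of_nonneg_left (ineq126_of_volumeLeaf G hΔ hV le_rfl c) (Real.exp_nonneg _)

/-- The same with the printed reading `d₀ = 1` of "d_j(X) ≠ 0" SUPPLIED AS A HYPOTHESIS `hGap` (every domain above `□`
other than those of size zero has `d_j ≥ 1`; [I] p. 257 geometry, not modelled — F5): the sub-sum of (1.26) over
`d_j(X) ≠ 0` is at most `exp(−(κ − κ₀(c₀,Δ)))·K₀(c₀,Δ)`.  [cite: Balaban1988RG2Cluster, (1.26) p.8] -/
theorem offDiag_le_of_gap {S : LocDomainSys} (G : CubeSystem S) {Δ : ℕ} (hΔ : G.DegreeLE Δ)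
    {c₀ : ℝ} (hV : G.VolumeLeaf c₀) {κ : ℝ} (hκ : kappa₀ c₀ Δ ≤ κ) (c : G.Cube)
    (hGap : ∀ X, S.dj X ≠ 0 → 1 ≤ S.dj X) :
    ∑ X ∈ (G.above c).filter (fun X => S.dj X ≠ 0), Real.exp (-κ * S.dj X)
      ≤ Real.exp (-(κ - kappa₀ c₀ Δ)) * K₀ c₀ Δ := by
  have hsub : (G.above c).filter (fun X => S.dj X ≠ 0) ⊆ (G.above c).filter (fun X => (1 : ℝ) ≤ S.dj X) := by
    intro X hX
    rw [Finset.mem_filter] at hX ⊢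
    exact ⟨hX.1, hGap X hX.2⟩
  calc ∑ X ∈ (G.above c).filter (fun X => S.dj X ≠ 0), Real.exp (-κ * S.dj X)
      ≤ ∑ X ∈ (G.above c).filter (fun X => (1 : ℝ) ≤ S.dj X), Real.exp (-κ * S.dj X) :=
        Finset.sum_le_sum_of_subset_of_nonneg hsub fun X _ _ => Real.exp_nonneg _
    _ ≤ Real.exp (-(κ - kappa₀ c₀ Δ) * 1) * K₀ c₀ Δ := offDiag_le G hΔ hV hκ c 1
    _ = Real.exp (-(κ - kappa₀ c₀ Δ)) * K₀ c₀ Δ := by rw [mul_one]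

end Literature.MathematicalPhysics.QuantumFieldTheory.Balaban1983to89.B12TreeDecay
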